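import Summits.MatrixMultiplication.OmegaCensus.SmallFormats.RankOneXFormsLowerBound
import HarnessLib

/-!
# ω-census family (a): `∑_t rank(X-form_t) ≥ k·m·n` for every decomposition of `⟨k,m,n⟩`

Cell `pub-omega` (unit `pub-omega-tensor-g4`), topic `Summits/MatrixMultiplication/OmegaCensus`. Framing (verbatim):
lottery ticket; floor = certified bounds/negative ranges.

Corollary of the landed '4-way flattening lemma' `RankOneXForms.kmn_le_card_of_rankOne_X`: if in a triad
decomposition `⟨k,m,n⟩ = ∑_s w_s ⊗ u_s ⊗ v_s` each X-component is written as a sum of `ρ_s` products,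
`u_s (κ, μ) = ∑_{j < ρ_s} r_{s,j} κ · c_{s,j} μ` (i.e. `rank u_s ≤ ρ_s` as a `k × m` matrix), then
`k·m·n ≤ ∑_s ρ_s`. Proof: split every term into its `ρ_s` rank-one pieces and apply the lemma to the
refined decomposition indexed by `Σ s, Fin ρ_s`. Use: in a rank-`r` decomposition of `⟨2,2,n⟩` at least
`4n − r` terms carry a rank-2 X-form (at `⟨2,2,5⟩@17`: at least 3), an implied constraint for the census'
case analyses. No new bound on any rank is claimed.
-/

namespace Summit.MatrixMultiplication.OmegaCensus

namespace RankOneXForms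

variable {K : Type} [Field K]

open Literature.Computability.AlgebraicComplexity in
/-- A triad is additive in its X-component over a finite sum. [folklore] -/
theorem triad_sum_mid {ι κ μ : Type} {ρ : ℕ} (w : ι → K) (u : Fin ρ → κ → K) (v : μ → K) :
    triad w (fun b => ∑ j, u j b) v = ∑ j, triad w (u j) v := by
  funext a b c
  simp only [triad_apply, Finset.sum_apply, Finset.mul_sum, Finset.sum_mul]

open Literature.Computability.AlgebraicComplexity in
/-- `∑_s ρ_s ≥ k·m·n` whenever every X-component `u_s` of a triad decomposition of `⟨k,m,n⟩` is a sum of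
`ρ_s` products of a row vector and a column vector (so this holds with `ρ_s = rank u_s`). [folklore] -/
theorem kmn_le_sum_rankBound_X (k m n : ℕ) {σ : Type} [Fintype σ]
    (w : σ → Fin k × Fin n → K) (u : σ → Fin k × Fin m → K) (v : σ → Fin m × Fin n → K)
    (hdec : matMulTensor K k m n = ∑ s, triad (w s) (u s) (v s))
    (ρ : σ → ℕ) (r : (s : σ) → Fin (ρ s) → Fin k → K) (c : (s : σ) → Fin (ρ s) → Fin m → K)
    (hfac : ∀ s κ μ, u s (κ, μ) = ∑ j, r s j κ * c s j μ) :
    k * m * n ≤ ∑ s, ρ s := by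
  classical
  -- the refined decomposition, indexed by Σ s, Fin (ρ s)
  let w' : (Σ s, Fin (ρ s)) → Fin k × Fin n → K := fun p => w p.1
  let u' : (Σ s, Fin (ρ s)) → Fin k × Fin m → K := fun p x => r p.1 p.2 x.1 * c p.1 p.2 x.2
  let v' : (Σ s, Fin (ρ s)) → Fin m × Fin n → K := fun p => v p.1
  have hu : ∀ s, u s = fun x : Fin k × Fin m => ∑ j, r s j x.1 * c s j x.2 := by
    intro s; funext x; obtain ⟨κ, μ⟩ := x; exact hfac s κ μ
  have hdec' : matMulTensor K k m n = ∑ p, triad (w' p) (u' p) (v' p) := by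
    rw [hdec, Fintype.sum_sigma]
    refine Finset.sum_congr rfl fun s _ => ?_
    rw [hu s]
    exact triad_sum_mid (w s) (fun j (x : Fin k × Fin m) => r s j x.1 * c s j x.2) (v s)
  have h := kmn_le_card_of_rankOne_X k m n w' u' v' hdec' (fun p => ⟨r p.1 p.2, c p.1 p.2, fun κ μ => rfl⟩)
  simpa [Fintype.card_sigma] using h

open Literature.Computability.AlgebraicComplexity in
/-- Specialisation: in an `r`-term decomposition of `⟨2,2,n⟩` whose X-forms have rank bounds `ρ_s ∈ {1,2}`,
`4n ≤ ∑_s ρ_s`; hence at least `4n − r` terms have a rank-2 X-form. [folklore] -/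
theorem four_mul_le_sum_rankBound_X_22n (n : ℕ) {σ : Type} [Fintype σ]
    (w : σ → Fin 2 × Fin n → K) (u : σ → Fin 2 × Fin 2 → K) (v : σ → Fin 2 × Fin n → K)
    (hdec : matMulTensor K 2 2 n = ∑ s, triad (w s) (u s) (v s))
    (ρ : σ → ℕ) (r : (s : σ) → Fin (ρ s) → Fin 2 → K) (c : (s : σ) → Fin (ρ s) → Fin 2 → K)
    (hfac : ∀ s κ μ, u s (κ, μ) = ∑ j, r s j κ * c s j μ) :
    4 * n ≤ ∑ s, ρ s := by
  have h := kmn_le_sum_rankBound_X 2 2 n w u v hdec ρ r c hfac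
  omega

end RankOneXForms

end Summit.MatrixMultiplication.OmegaCensus
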